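import Summits.QuantumAdvantage.AdviceFreeQNC0.AffBells22FibreSum
import Summits.QuantumAdvantage.AdviceFreeQNC0.AffBells22KernelZeros
import HarnessLib

/-!
# Sketch22 §2c (frame averaging), step F2: the frozen twist bound

For a frozen `1`-junta strategy `y` (`y_k` reads at most the one bit in `T_k`) and a frequency
`γ : Fin N → ZMod 3`,

  `‖Σ_{x odd} (−1)^{⟨J(x), stake(y,x)⟩} ω^{⟨γ,x⟩}‖ ≤ (200/39) · (39/40)^{wt γ} · 2^{N−1}`

(`norm_twist_sum_le`).  The odd patterns are grouped by kernel line; each fibre contributes at most the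
word weight `Π_{J_i = 0} w_γ(i)` with `w_γ = √3` on `supp γ` and `2` off it (`AffBells22FibreSum`), the
kernel lines are hard-core words (`Fib19.kline_hardCore`, `noAdj_of_hardCore`), and the linear hard-core
word sum is controlled by the quadratic potential of `AffBells22HardcoreWords` in the mixed regime
(weights `≤ 2`, and `≤ 7/4` on `supp γ`: per-site factor `19/20 ≤ (39/40)²`, `total_le_two_mixed`).
This is the per-frequency estimate behind `FrameAveragingOne` (`AffBells22FrameAveragingOne`).
-/

namespace Summit.QuantumAdvantage.AdviceFreeQNC0

open Finset Literature.Computability.QuantumComplexity Literature.Computability.QuantumComplexity.RingHLF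
open Literature.Computability.MetaComplexity

namespace AffBells22

/-! ## The mixed iteration: weights `≤ 2`, and `≤ 7/4` on `L` -/

/-- **Potential bound along the word**, mixed version: weights `0 ≤ w_i ≤ 2` everywhere and a per-site contraction factor
`19/20` where `w_i ≤ 7/4` is certified by `i ∈ L`: `qf(A_j, B_j) ≤ 17 · 4^j · (19/20)^{#{i ∈ L : 1 ≤ i ≤ j}}`. -/
theorem qf_endSum_le_mixed (w : ℕ → ℝ) (hw0 : ∀ i, 0 ≤ w i) (hw2 : ∀ i, w i ≤ 2) (L : Finset ℕ)
    (hL : ∀ i ∈ L, w i ≤ 7 / 4) (j : ℕ) :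
    qf (endSum w j true) (endSum w j false)
      ≤ 17 * 4 ^ j * (19 / 20 : ℝ) ^ (L.filter fun i => 1 ≤ i ∧ i ≤ j).card := by
  induction j with
  | zero =>
    obtain ⟨h1, h2⟩ := endSum_zero w
    rw [h1, h2]
    have hc : (L.filter fun i => 1 ≤ i ∧ i ≤ 0).card = 0 := by
      rw [Finset.card_eq_zero, Finset.filter_eq_empty_iff]
      intro i _ h; omega
    rw [hc, pow_zero, pow_zero, mul_one, mul_one]
    unfold qf
    nlinarith [hw0 0, hw2 0]
  | succ j ih =>
    rw [endSum_succ_true, endSum_succ_false]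
    have hA := endSum_nonneg hw0 j true
    have hB := endSum_nonneg hw0 j false
    by_cases hmem : (j + 1) ∈ L
    · have hcard : (L.filter fun i => 1 ≤ i ∧ i ≤ j + 1).card = (L.filter fun i => 1 ≤ i ∧ i ≤ j).card + 1 := by
        have : (L.filter fun i => 1 ≤ i ∧ i ≤ j + 1) = insert (j + 1) (L.filter fun i => 1 ≤ i ∧ i ≤ j) := by
          ext i
          simp only [mem_filter, mem_insert]
          constructor
          · rintro ⟨hi, h1, h2⟩
            by_cases h : i = j + 1
            · exact Or.inl h
            · exact Or.inr ⟨hi, h1, by omega⟩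
          · rintro (h | ⟨hi, h1, h2⟩)
            · subst h; exact ⟨hmem, by omega, le_rfl⟩
            · exact ⟨hi, h1, by omega⟩
        rw [this, card_insert_of_notMem (by simp)]
      rw [hcard, pow_succ, pow_succ]
      have hstep := qf_step_seven_quarters hA hB (hw0 (j + 1)) (hL _ hmem)
      nlinarith [hstep, ih, qf_nonneg (endSum w j true) (endSum w j false)]
    · have hcard : (L.filter fun i => 1 ≤ i ∧ i ≤ j + 1).card = (L.filter fun i => 1 ≤ i ∧ i ≤ j).card := by
        congr 1
        ext i
        simp only [mem_filter]
        constructor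
        · rintro ⟨hi, h1, h2⟩
          have : i ≠ j + 1 := fun h => hmem (h ▸ hi)
          exact ⟨hi, h1, by omega⟩
        · rintro ⟨hi, h1, h2⟩
          exact ⟨hi, h1, by omega⟩
      rw [hcard, pow_succ]
      have hstep := qf_step_two hA hB (hw0 (j + 1)) (hw2 (j + 1))
      have h19 : (0 : ℝ) ≤ (19 / 20 : ℝ) ^ (L.filter fun i => 1 ≤ i ∧ i ≤ j).card := by positivity
      nlinarith [hstep, ih, qf_nonneg (endSum w j true) (endSum w j false), h19]

/-- **Weights `≤ 2`, and `≤ 7/4` on the (ℕ-coded) set `L`**: `S ≤ 5 · (39/40)^{#L'} · 2^j` over words of length `j+1`,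
where `L' = L ∩ [1, j]` (`19/20 ≤ (39/40)²`). -/
theorem total_le_two_mixed (w : ℕ → ℝ) (hw0 : ∀ i, 0 ≤ w i) (hw2 : ∀ i, w i ≤ 2) (L : Finset ℕ)
    (hL : ∀ i ∈ L, w i ≤ 7 / 4) (j : ℕ) :
    ∑ v : Fin (j + 1) → Bool, (if NoAdj v then wordWt w v else 0)
      ≤ 5 * (39 / 40 : ℝ) ^ (L.filter fun i => 1 ≤ i ∧ i ≤ j).card * 2 ^ j := by
  rw [total_eq]
  set d := (L.filter fun i => 1 ≤ i ∧ i ≤ j).card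
  have hq := qf_endSum_le_mixed w hw0 hw2 L hL j
  have hS := sq_add_le_qf (endSum w j true) (endSum w j false)
  apply le_of_sq_le (by positivity)
  have h19 : (19 / 20 : ℝ) ^ d ≤ ((39 / 40 : ℝ) ^ 2) ^ d :=
    pow_le_pow_left₀ (by norm_num) (by norm_num) d
  have h4 : (4 : ℝ) ^ j = (2 ^ j) ^ 2 := by rw [← pow_mul, mul_comm, pow_mul]; norm_num
  have h39 : ((39 / 40 : ℝ) ^ 2) ^ d = ((39 / 40 : ℝ) ^ d) ^ 2 := by rw [← pow_mul, ← pow_mul, mul_comm]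
  calc (endSum w j true + endSum w j false) ^ 2 ≤ 17 * 4 ^ j * (19 / 20 : ℝ) ^ d := hS.trans hq
    _ ≤ 25 * 4 ^ j * ((39 / 40 : ℝ) ^ 2) ^ d := by gcongr; norm_num
    _ = (5 * (39 / 40 : ℝ) ^ d * 2 ^ j) ^ 2 := by rw [h4, h39]; ring

/-! ## The frozen twist bound -/

/-- `√3 ≤ 7/4`. -/
theorem sqrt_three_le : Real.sqrt 3 ≤ 7 / 4 := by
  rw [show (7 / 4 : ℝ) = Real.sqrt ((7 / 4) ^ 2) by rw [Real.sqrt_sq (by norm_num)]]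
  exact Real.sqrt_le_sqrt (by norm_num)

variable {N : ℕ}

/-- The coin weights are non-negative. -/
theorem wtGamma_nonneg (γ : Fin N → ZMod 3) (i : ℕ) : 0 ≤ wtGamma γ i := by
  unfold wtGamma; split_ifs
  · exact Real.sqrt_nonneg 3
  · norm_num

/-- The coin weights are at most `2`. -/
theorem wtGamma_le_two (γ : Fin N → ZMod 3) (i : ℕ) : wtGamma γ i ≤ 2 := by
  unfold wtGamma; split_ifs
  · exact sqrt_three_le.trans (by norm_num)
  · exact le_rfl

/-- On the support of `γ` the coin weight is `√3 ≤ 7/4`. -/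
theorem wtGamma_le_of_mem (γ : Fin N → ZMod 3) (i : ℕ)
    (hi : i ∈ (univ.filter fun i : Fin N => γ i ≠ 0).map Fin.valEmbedding) : wtGamma γ i ≤ 7 / 4 := by
  unfold wtGamma; rw [if_pos hi]; exact sqrt_three_le

/-- The tail exponent: `#(L ∩ [1, m]) ≥ #supp γ − 1` for `L = supp γ ⊆ [0, m]`. -/
theorem card_supp_le_filter_succ {m : ℕ} (D : Finset (Fin (m + 1))) :
    D.card ≤ ((D.map Fin.valEmbedding).filter fun i => 1 ≤ i ∧ i ≤ m).card + 1 := by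
  have hsub : (D.map Fin.valEmbedding) ⊆ insert 0 ((D.map Fin.valEmbedding).filter fun i => 1 ≤ i ∧ i ≤ m) := by
    intro i hi
    rw [mem_insert, mem_filter]
    by_cases h0 : i = 0
    · exact Or.inl h0
    · refine Or.inr ⟨hi, by omega, ?_⟩
      obtain ⟨k, _, rfl⟩ := Finset.mem_map.mp hi
      have := k.2
      simp only [Fin.valEmbedding_apply]
      omega
  have := (card_le_card hsub).trans (card_insert_le _ _)
  rw [card_map] at this
  omega

/-- Geometric bookkeeping: `κ^d ≤ κ⁻¹ · κ^{c}` when `c ≤ d + 1` (`κ = 39/40`). -/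
theorem kappa_pow_le {c d : ℕ} (h : c ≤ d + 1) : (39 / 40 : ℝ) ^ d ≤ (40 / 39) * (39 / 40 : ℝ) ^ c := by
  have h1 := pow_le_pow_of_le_one (by norm_num : (0 : ℝ) ≤ 39 / 40) (by norm_num) (by omega : c - 1 ≤ d)
  refine h1.trans ?_
  rcases Nat.eq_zero_or_pos c with hz | hpos
  · rw [hz]; norm_num
  · have : (39 / 40 : ℝ) ^ c = (39 / 40) * (39 / 40 : ℝ) ^ (c - 1) := by
      rw [← pow_succ']; congr 1; omega
    rw [this]
    nlinarith [pow_nonneg (by norm_num : (0:ℝ) ≤ 39 / 40) (c - 1)]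

/-- **THE FROZEN TWIST BOUND** (`w₀ ≤ 1`): for a frozen `1`-junta strategy `y` and any frequency `γ`,
`‖Σ_{x odd} (−1)^{⟨J(x), stake(y,x)⟩} ω^{⟨γ,x⟩}‖ ≤ (200/39) · (39/40)^{wt γ} · 2^{N−1}`.
Proof: fibre over the kernel line (`norm_fibre_twist_le`: each fibre sum is at most the word weight `Π_{J_i=0} w_γ(i)`),
then the hard-core word sum with weights `2` off `supp γ` and `√3 ≤ 7/4` on it (`total_le_two_mixed`). -/
theorem norm_twist_sum_le (hN : 3 ≤ N) (T : Fin N → Finset (Fin N)) (y : Fin N → (Fin N → Bool) → Bool)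
    (hT : ∀ k, (T k).card ≤ 1) (hy : ∀ k, ReadsOnly (T k) (y k)) (γ : Fin N → ZMod 3) :
    ‖∑ x ∈ (univ : Finset (Fin N → Bool)).filter (fun x => Fib19.IsOdd x),
        (-1 : ℂ) ^ dot2 (Fib19.kline x) (Fib19.stake (fun x k => y k x) x)
          * (ZMod.stdAddChar (∑ i : Fin N, if x i then γ i else 0) : ℂ)‖
      ≤ 200 / 39 * (39 / 40 : ℝ) ^ (univ.filter fun i : Fin N => γ i ≠ 0).card * (2 : ℝ) ^ (N - 1) := by
  obtain ⟨m, rfl⟩ : ∃ m, N = m + 1 := ⟨N - 1, by omega⟩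
  set O := (univ : Finset (Fin (m + 1) → Bool)).filter (fun x => Fib19.IsOdd x) with hO
  set Φ : (Fin (m + 1) → Bool) → ℂ := fun x => (-1 : ℂ) ^ dot2 (Fib19.kline x) (Fib19.stake (fun x k => y k x) x)
      * (ZMod.stdAddChar (∑ i : Fin (m + 1), if x i then γ i else 0) : ℂ) with hΦ
  have hmaps : ∀ x ∈ O, Fib19.kline x ∈ O.image Fib19.kline := fun x hx => mem_image_of_mem _ hx
  rw [← sum_fiberwise_of_maps_to hmaps]
  -- per-fibre bound
  have hfib : ∀ J ∈ O.image Fib19.kline,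
      ‖∑ x ∈ O.filter (fun x => Fib19.kline x = J), Φ x‖ ≤ wordWt (wtGamma γ) J := by
    intro J hJ
    obtain ⟨x₀, hx₀, rfl⟩ := mem_image.mp hJ
    exact norm_fibre_twist_le hN (mem_filter.mp hx₀).2 T y hT hy γ
  -- the kernel lines are hard-core, hence linear hard-core words
  have hsub : O.image Fib19.kline ⊆ univ.filter (fun v : Fin (m + 1) → Bool => NoAdj v) := by
    intro J hJ
    obtain ⟨x₀, hx₀, rfl⟩ := mem_image.mp hJ
    exact mem_filter.mpr ⟨mem_univ _, noAdj_of_hardCore (Fib19.kline_hardCore hN x₀ (mem_filter.mp hx₀).2)⟩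
  set D := univ.filter fun i : Fin (m + 1) => γ i ≠ 0 with hD
  have h3 := total_le_two_mixed (wtGamma γ) (wtGamma_nonneg γ) (wtGamma_le_two γ) (D.map Fin.valEmbedding)
    (fun i hi => wtGamma_le_of_mem γ i hi) m
  have hκ := kappa_pow_le (card_supp_le_filter_succ D)
  rw [Nat.add_sub_cancel]
  have h2q : (0 : ℝ) ≤ 2 ^ m := by positivity
  calc ‖∑ J ∈ O.image Fib19.kline, ∑ x ∈ O.filter (fun x => Fib19.kline x = J), Φ x‖
      ≤ ∑ J ∈ O.image Fib19.kline, ‖∑ x ∈ O.filter (fun x => Fib19.kline x = J), Φ x‖ := norm_sum_le _ _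
    _ ≤ ∑ J ∈ O.image Fib19.kline, wordWt (wtGamma γ) J := sum_le_sum hfib
    _ ≤ ∑ v : Fin (m + 1) → Bool, (if NoAdj v then wordWt (wtGamma γ) v else 0) := by
        rw [← sum_filter]
        exact sum_le_sum_of_subset_of_nonneg hsub (fun v _ _ => wordWt_nonneg (wtGamma_nonneg γ) v)
    _ ≤ _ := h3
    _ ≤ 5 * ((40 / 39) * (39 / 40 : ℝ) ^ D.card) * 2 ^ m := by gcongr
    _ = 200 / 39 * (39 / 40 : ℝ) ^ D.card * 2 ^ m := by ring

end AffBells22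

end Summit.QuantumAdvantage.AdviceFreeQNC0
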